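import Literature.MathematicalPhysics.QuantumFieldTheory.King1986.AliasSums
import Summits.QuantumFields.BalabanUV.Beta.GAN24.AliasReindex

/-!
# `BalabanUV.Beta.GAN24.AliasPointSum` — binder row G-an2-4 / (CONV-C), S-slot located remainder «E3Shape», route «S3-fibre²»
# (gan24-p1 `SKELETON-S3.md` v0.2, (S3-1) point readings / R-S3-1a «the curl gain must survive the alias sums»):
# THE `p`-FREE ALIAS ℓ¹ SUMS OF A POINT READING ARE KING (4.22) AT THE FICTITIOUS MOMENTUM `p* = (π, …, π)`

NOT IN PRINT; OUR PROOF ATTEMPT (of the road; THIS file is a [folklore] ENGINE: a termwise majorisation + one call of the tree's kernel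
reproduction of King 1986 (4.22), `King1986.AliasSums.alias_sum_le`).  HONEST FRAMING (cell contract, verbatim): «discharging `BetaPertH`
makes Bałaban's UV stability UNCONDITIONAL — a real constructive-QFT result; it is NOT the continuum limit and NOT the Clay problem.»
HONEST DEPENDENCY (verbatim): «continuum YM on T⁴ ⇐ BetaPertH ∧ nine spine estimates (0/9 proved); BetaPertH ⇐ (D1) ∧ (D4) ∧ CAP+tail;
G-an2-4 gates asym, D1 and NE2/3/4.»  No cited fact beyond the imported reproduction, no wall binder, no `def … : Prop`; discharges NOTHING of
(hS, hSall) / «E3Shape»; NOT `BetaPertH`, NOT continuum, NOT Clay.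

## Why (design note `HOME/b2b-balaban-gan24-formalise-leaf-16/g8/E3A-READOUT.md` §2(d), (f))
A POINT reading of the minimiser column of the inverse Bloch fibre pairs the alias amplitudes `Â_m` with a plane wave (all entries of modulus
`≈ 1`), so it needs an ℓ¹ — not ℓ² — alias bound; with the explicit per-alias solution (`FibreBlockSolve.Asol`) the amplitudes of the aliases
`m ≠ 0` are majorised by `N^{−(D+1)} · ‖m̃‖^{α−1} · Π_{μ: m̃_μ ≠ 0} |m̃_μ|⁻¹` with `α = −1` (transverse part), `α = −2` (pure-gauge part), and ONE
lattice curl on the leg raises `α` by one (`α = 0`, `−1`).  These weights carry NO small factor `|p_μ|` — they are `p`-free — but they are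
majorised, up to `(3π)^{1−α}·3^d`, by King's summand `aliasTerm α p* j` at `p* = (π, …, π)` (`|π|/|π + 2πj_μ| = 1/|1 + 2j_μ| ≥ 1/(3|j_μ|)`,
`‖p* + 2πj‖∞ ≤ 3π‖j‖∞`), so King's window-free bound applies verbatim for every `α < 1`.  (At `α = 1` — TWO curls — the sum diverges like
`(log K)^d`; not claimed.)

## What is proved (Mathlib + `King1986.AliasSums` + `GAN24/AliasReindex` (for §4 only); `d ≥ 1`, `α < 1`; sup norm `‖j‖ = max_μ |j_μ|` on `ℝ^d`)
* `pointWeight α j = ‖j‖^{α−1} · Π_μ [j_μ = 0 ? 1 : |j_μ|⁻¹]` (the `p`-free weight), `pointWeight_nonneg`;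
* `prod_inv_le_aliasWeight_piStar`: `Π_μ [j_μ = 0 ? 1 : |j_μ|⁻¹] ≤ 3^d · aliasWeight p* j`;
* `norm_aliasPt_piStar_le`: `‖aliasPt p* j‖ ≤ 3π‖j‖` (`j ≠ 0`); `rpow_norm_le`: `‖j‖^{α−1} ≤ (3π)^{1−α} · ‖aliasPt p* j‖^{α−1}` (`α ≤ 1`, `j ≠ 0`);
* **`pointWeight_le_aliasTerm`**: `pointWeight α j ≤ (3π)^{1−α} · 3^d · aliasTerm α p* j` (`j ≠ 0`, `α ≤ 1`);
* **`sum_pointWeight_le`**: `Σ_{j ∈ [−K,K]^d ∖ 0} pointWeight α j ≤ (3π)^{1−α} · 3^d · aliasConst d α`, uniformly in the window `K`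
  (`α < 1`, `d ≥ 1`), and **`sum_pointWeight_le_of_subset`** for ANY finite family of nonzero integer vectors;
* §4 THE TORUS FORM (the currency of `AliasObjects`/`StripAliasBounds`, aliases `m : TorusSite D N` read through leaf-14's SYMMETRIC representative
  `AliasReindex.srep m ∈ (−N/2, N/2]^D`): `srep_ne_zero`, **`sum_pointWeight_srep_le`**:
  `Σ_{m : TorusSite D N, m ≠ 0} pointWeight α (srep m) ≤ (3π)^{1−α} · 3^D · aliasConst D α`, uniformly in the block side `N`.
Unit `b2b-balaban-gan24-formalise-leaf-16` (G-an2-4 formalisation swarm, leaf prover 16, gen 8; records — idle-seat engine), 2026-08-20.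
-/

noncomputable section

open Real Finset

namespace Summit.QuantumFields.BalabanUV.Beta.GAN24.AliasPointSum

open Literature.MathematicalPhysics.QuantumFieldTheory.King1986

variable {d : ℕ}

/-! ## §1 The `p`-free point-reading weight and the fictitious momentum -/

/-- [folklore] The integer vector `j` read in `ℝ^d`. -/
def realVec (j : Fin d → ℤ) : Fin d → ℝ := fun μ => (j μ : ℝ)

/-- [folklore] THE `p`-FREE ALIAS WEIGHT OF A POINT READING: `‖j‖^{α−1} · Π_μ [j_μ = 0 ? 1 : |j_μ|⁻¹]` (sup norm). -/
def pointWeight (α : ℝ) (j : Fin d → ℤ) : ℝ :=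
  ‖realVec j‖ ^ (α - 1) * ∏ μ, (if j μ = 0 then (1 : ℝ) else |(j μ : ℝ)|⁻¹)

/-- [folklore] The fictitious momentum `p* = (π, …, π)` (a corner of the Brillouin zone). -/
def piStar (d : ℕ) : Fin d → ℝ := fun _ => π

/-- [folklore] `|p*_μ| ≤ π`. -/
theorem abs_piStar_le (μ : Fin d) : |piStar d μ| ≤ π := by
  unfold piStar; rw [abs_of_nonneg Real.pi_pos.le]

/-- [folklore] The `p`-free product weight is nonnegative. -/
theorem prod_inv_nonneg (j : Fin d → ℤ) : 0 ≤ ∏ μ, (if j μ = 0 then (1 : ℝ) else |(j μ : ℝ)|⁻¹) :=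
  Finset.prod_nonneg fun μ _ => by split_ifs <;> positivity

/-- [folklore] `pointWeight` is nonnegative. -/
theorem pointWeight_nonneg (α : ℝ) (j : Fin d → ℤ) : 0 ≤ pointWeight α j :=
  mul_nonneg (rpow_nonneg (norm_nonneg _) _) (prod_inv_nonneg j)

/-- [folklore] A nonzero integer vector has sup norm `≥ 1`. -/
theorem one_le_norm_realVec {j : Fin d → ℤ} (hj : j ≠ 0) : 1 ≤ ‖realVec j‖ := by
  obtain ⟨μ, hμ⟩ : ∃ μ, j μ ≠ 0 := by
    by_contra h
    exact hj (funext fun μ => by simpa using (not_exists.1 h) μ)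
  have h1 : (1 : ℝ) ≤ |(j μ : ℝ)| := by rw [← Int.cast_abs]; exact_mod_cast Int.one_le_abs hμ
  have h2 : ‖realVec j μ‖ ≤ ‖realVec j‖ := norm_le_pi_norm _ μ
  rw [Real.norm_eq_abs] at h2
  exact h1.trans h2

/-- [folklore] Every coordinate is bounded by the sup norm: `|j_μ| ≤ ‖j‖`. -/
theorem abs_le_norm_realVec (j : Fin d → ℤ) (μ : Fin d) : |(j μ : ℝ)| ≤ ‖realVec j‖ := by
  have h := norm_le_pi_norm (realVec j) μ
  rwa [Real.norm_eq_abs] at h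

/-! ## §2 Termwise majorisation by King's summand at `p*` -/

/-- [folklore] One coordinate of the alias point at `p*`: `|π + 2πj_μ| ≤ 3π‖j‖` for `j ≠ 0`. -/
theorem abs_aliasPt_piStar_le {j : Fin d → ℤ} (hj : j ≠ 0) (μ : Fin d) :
    |aliasPt (piStar d) j μ| ≤ 3 * π * ‖realVec j‖ := by
  have h1 := one_le_norm_realVec hj
  have hμ := abs_le_norm_realVec j μ
  unfold aliasPt piStar
  calc |π + 2 * π * (j μ : ℝ)| ≤ |π| + |2 * π * (j μ : ℝ)| := abs_add_le _ _
    _ = π + 2 * π * |(j μ : ℝ)| := by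
        rw [abs_of_nonneg Real.pi_pos.le, abs_mul, abs_of_nonneg (by positivity : (0:ℝ) ≤ 2 * π)]
    _ ≤ π * ‖realVec j‖ + 2 * π * ‖realVec j‖ := by
        have := Real.pi_pos
        nlinarith
    _ = 3 * π * ‖realVec j‖ := by ring

/-- [folklore] `‖aliasPt p* j‖ ≤ 3π‖j‖` for `j ≠ 0` (sup norm). -/
theorem norm_aliasPt_piStar_le {j : Fin d → ℤ} (hj : j ≠ 0) : ‖aliasPt (piStar d) j‖ ≤ 3 * π * ‖realVec j‖ := by
  refine (pi_norm_le_iff_of_nonneg (by have := Real.pi_pos; positivity)).2 fun μ => ?_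
  rw [Real.norm_eq_abs]
  exact abs_aliasPt_piStar_le hj μ

/-- [folklore] THE NORM FACTOR: `‖j‖^{α−1} ≤ (3π)^{1−α} · ‖aliasPt p* j‖^{α−1}` for `α ≤ 1`, `j ≠ 0` (antitonicity of `x ↦ x^{α−1}`). -/
theorem rpow_norm_le {α : ℝ} (hα : α ≤ 1) {j : Fin d → ℤ} (hj : j ≠ 0) :
    ‖realVec j‖ ^ (α - 1) ≤ (3 * π) ^ (1 - α) * ‖aliasPt (piStar d) j‖ ^ (α - 1) := by
  have hq : (1 : ℝ) ≤ ‖aliasPt (piStar d) j‖ := one_le_norm_aliasPt abs_piStar_le hj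
  have hq0 : 0 < ‖aliasPt (piStar d) j‖ := by linarith
  have h3 : (0 : ℝ) < 3 * π := by have := Real.pi_pos; positivity
  have hj0 : 0 ≤ ‖realVec j‖ := norm_nonneg _
  -- (3π‖j‖)^{α−1} ≤ ‖aliasPt‖^{α−1}
  have hmono : (3 * π * ‖realVec j‖) ^ (α - 1) ≤ ‖aliasPt (piStar d) j‖ ^ (α - 1) :=
    Real.rpow_le_rpow_of_nonpos hq0 (norm_aliasPt_piStar_le hj) (by linarith)
  rw [Real.mul_rpow h3.le hj0] at hmono
  -- multiply by (3π)^{1−α} and use (3π)^{1−α} (3π)^{α−1} = 1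
  have hinv : (3 * π) ^ (1 - α) * (3 * π) ^ (α - 1) = 1 := by
    rw [← Real.rpow_add h3]; norm_num
  have hpos : 0 ≤ (3 * π) ^ (1 - α) := rpow_nonneg h3.le _
  calc ‖realVec j‖ ^ (α - 1) = (3 * π) ^ (1 - α) * ((3 * π) ^ (α - 1) * ‖realVec j‖ ^ (α - 1)) := by
        rw [← mul_assoc, hinv, one_mul]
    _ ≤ (3 * π) ^ (1 - α) * ‖aliasPt (piStar d) j‖ ^ (α - 1) := mul_le_mul_of_nonneg_left hmono hpos

/-- [folklore] One coordinate of the product weight: `[j_μ = 0 ? 1 : |j_μ|⁻¹] ≤ 3 · [j_μ = 0 ? 1 : |π|/|π + 2πj_μ|]`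
(`|1 + 2j_μ| ≤ 3|j_μ|` for `j_μ ≠ 0`). -/
theorem inv_le_three_mul_weight (j : Fin d → ℤ) (μ : Fin d) :
    (if j μ = 0 then (1 : ℝ) else |(j μ : ℝ)|⁻¹)
      ≤ 3 * (if j μ = 0 then (1 : ℝ) else |piStar d μ| / |piStar d μ + 2 * π * j μ|) := by
  split_ifs with h
  · norm_num
  · unfold piStar
    have h1 : (1 : ℝ) ≤ |(j μ : ℝ)| := by rw [← Int.cast_abs]; exact_mod_cast Int.one_le_abs h
    have hj0 : 0 < |(j μ : ℝ)| := by linarith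
    have hπ := Real.pi_pos
    have hden : |π + 2 * π * (j μ : ℝ)| ≤ 3 * π * |(j μ : ℝ)| := by
      calc |π + 2 * π * (j μ : ℝ)| ≤ |π| + |2 * π * (j μ : ℝ)| := abs_add_le _ _
        _ = π + 2 * π * |(j μ : ℝ)| := by
            rw [abs_of_nonneg hπ.le, abs_mul, abs_of_nonneg (by positivity : (0:ℝ) ≤ 2 * π)]
        _ ≤ 3 * π * |(j μ : ℝ)| := by nlinarith
    have hden0 : 0 < |π + 2 * π * (j μ : ℝ)| := lt_of_lt_of_le (by positivity) (pi_le_abs_add (abs_piStar_le (d := d) μ) h)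
    rw [abs_of_nonneg hπ.le]
    -- |j_μ|⁻¹ ≤ 3 · π / |π + 2πj_μ|  ⟸  |π + 2πj_μ| ≤ 3π|j_μ|
    rw [show (3 : ℝ) * (π / |π + 2 * π * (j μ : ℝ)|) = (3 * π) / |π + 2 * π * (j μ : ℝ)| by ring, le_div_iff₀ hden0]
    calc |(j μ : ℝ)|⁻¹ * |π + 2 * π * (j μ : ℝ)| ≤ |(j μ : ℝ)|⁻¹ * (3 * π * |(j μ : ℝ)|) :=
          mul_le_mul_of_nonneg_left hden (inv_nonneg.2 hj0.le)
      _ = 3 * π := by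
          rw [show |(j μ : ℝ)|⁻¹ * (3 * π * |(j μ : ℝ)|) = 3 * π * (|(j μ : ℝ)|⁻¹ * |(j μ : ℝ)|) by ring,
            inv_mul_cancel₀ hj0.ne', mul_one]

/-- [folklore] THE PRODUCT FACTOR: `Π_μ [j_μ = 0 ? 1 : |j_μ|⁻¹] ≤ 3^d · aliasWeight p* j`. -/
theorem prod_inv_le_aliasWeight_piStar (j : Fin d → ℤ) :
    ∏ μ, (if j μ = 0 then (1 : ℝ) else |(j μ : ℝ)|⁻¹) ≤ (3 : ℝ) ^ d * aliasWeight (piStar d) j := by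
  unfold aliasWeight
  calc ∏ μ, (if j μ = 0 then (1 : ℝ) else |(j μ : ℝ)|⁻¹)
      ≤ ∏ μ, 3 * (if j μ = 0 then (1 : ℝ) else |piStar d μ| / |piStar d μ + 2 * π * j μ|) :=
        Finset.prod_le_prod (fun μ _ => by split_ifs <;> positivity) fun μ _ => inv_le_three_mul_weight j μ
    _ = (3 : ℝ) ^ d * ∏ μ, (if j μ = 0 then (1 : ℝ) else |piStar d μ| / |piStar d μ + 2 * π * j μ|) := by
        rw [Finset.prod_mul_distrib, Finset.prod_const, Finset.card_univ, Fintype.card_fin]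

/-- [folklore] **TERMWISE MAJORISATION**: `pointWeight α j ≤ (3π)^{1−α} · 3^d · aliasTerm α p* j` for `j ≠ 0`, `α ≤ 1`. -/
theorem pointWeight_le_aliasTerm {α : ℝ} (hα : α ≤ 1) {j : Fin d → ℤ} (hj : j ≠ 0) :
    pointWeight α j ≤ (3 * π) ^ (1 - α) * (3 : ℝ) ^ d * aliasTerm α (piStar d) j := by
  unfold pointWeight aliasTerm
  have h1 := rpow_norm_le hα hj
  have h2 := prod_inv_le_aliasWeight_piStar j
  have ha : 0 ≤ (3 * π) ^ (1 - α) * ‖aliasPt (piStar d) j‖ ^ (α - 1) :=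
    mul_nonneg (rpow_nonneg (by have := Real.pi_pos; positivity) _) (rpow_nonneg (norm_nonneg _) _)
  calc ‖realVec j‖ ^ (α - 1) * ∏ μ, (if j μ = 0 then (1 : ℝ) else |(j μ : ℝ)|⁻¹)
      ≤ ((3 * π) ^ (1 - α) * ‖aliasPt (piStar d) j‖ ^ (α - 1)) * ((3 : ℝ) ^ d * aliasWeight (piStar d) j) :=
        mul_le_mul h1 h2 (prod_inv_nonneg j) ha
    _ = (3 * π) ^ (1 - α) * (3 : ℝ) ^ d * (‖aliasPt (piStar d) j‖ ^ (α - 1) * aliasWeight (piStar d) j) := by ring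

/-! ## §3 The window-free ℓ¹ bounds -/

/-- [folklore] **THE `p`-FREE POINT-READING ALIAS SUM IS BOUNDED UNIFORMLY IN THE WINDOW** (`d ≥ 1`, `α < 1`):
`Σ_{j ∈ [−K,K]^d, j ≠ 0} ‖j‖^{α−1} Π_μ^{active} |j_μ|⁻¹ ≤ (3π)^{1−α} · 3^d · aliasConst d α` — King (4.22) at `p* = (π,…,π)`. -/
theorem sum_pointWeight_le (hd : 0 < d) {α : ℝ} (hα : α < 1) (K : ℕ) :
    ∑ j ∈ (aliasBox d K).erase 0, pointWeight α j ≤ (3 * π) ^ (1 - α) * (3 : ℝ) ^ d * aliasConst d α := by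
  calc ∑ j ∈ (aliasBox d K).erase 0, pointWeight α j
      ≤ ∑ j ∈ (aliasBox d K).erase 0, (3 * π) ^ (1 - α) * (3 : ℝ) ^ d * aliasTerm α (piStar d) j :=
        Finset.sum_le_sum fun j hj => pointWeight_le_aliasTerm hα.le (Finset.ne_of_mem_erase hj)
    _ = (3 * π) ^ (1 - α) * (3 : ℝ) ^ d * ∑ j ∈ (aliasBox d K).erase 0, aliasTerm α (piStar d) j := by
        rw [Finset.mul_sum]
    _ ≤ (3 * π) ^ (1 - α) * (3 : ℝ) ^ d * aliasConst d α :=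
        mul_le_mul_of_nonneg_left (alias_sum_le hd hα abs_piStar_le K)
          (mul_nonneg (rpow_nonneg (by have := Real.pi_pos; positivity) _) (pow_nonneg (by norm_num) _))

/-- [folklore] **The same for ANY finite family of nonzero integer vectors** (the aliases actually present at block side `N`,
read through representatives). -/
theorem sum_pointWeight_le_of_subset (hd : 0 < d) {α : ℝ} (hα : α < 1) {Λ : Finset (Fin d → ℤ)}
    (h0 : (0 : Fin d → ℤ) ∉ Λ) :
    ∑ j ∈ Λ, pointWeight α j ≤ (3 * π) ^ (1 - α) * (3 : ℝ) ^ d * aliasConst d α := by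
  have hne : ∀ j ∈ Λ, j ≠ 0 := fun j hj h => h0 (h ▸ hj)
  calc ∑ j ∈ Λ, pointWeight α j
      ≤ ∑ j ∈ Λ, (3 * π) ^ (1 - α) * (3 : ℝ) ^ d * aliasTerm α (piStar d) j :=
        Finset.sum_le_sum fun j hj => pointWeight_le_aliasTerm hα.le (hne j hj)
    _ = (3 * π) ^ (1 - α) * (3 : ℝ) ^ d * ∑ j ∈ Λ, aliasTerm α (piStar d) j := by rw [Finset.mul_sum]
    _ ≤ (3 * π) ^ (1 - α) * (3 : ℝ) ^ d * aliasConst d α :=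
        mul_le_mul_of_nonneg_left (alias_sum_le_of_subset hd hα abs_piStar_le h0)
          (mul_nonneg (rpow_nonneg (by have := Real.pi_pos; positivity) _) (pow_nonneg (by norm_num) _))

/-- [folklore] THE THREE CONSUMER EXPONENTS of the point reading (design note §2(c),(f)): transverse part `α = −1` (weight `‖j‖^{−2}`),
pure-gauge part `α = −2` (`‖j‖^{−3}`), ONE lattice curl on the leg `α = 0` (`‖j‖^{−1}`) — all `< 1`, so all three sums are window-free. -/
theorem sum_pointWeight_le_three (hd : 0 < d) (K : ℕ) :
    (∑ j ∈ (aliasBox d K).erase 0, pointWeight (-1) j ≤ (3 * π) ^ (2 : ℝ) * (3 : ℝ) ^ d * aliasConst d (-1)) ∧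
    (∑ j ∈ (aliasBox d K).erase 0, pointWeight (-2) j ≤ (3 * π) ^ (3 : ℝ) * (3 : ℝ) ^ d * aliasConst d (-2)) ∧
    (∑ j ∈ (aliasBox d K).erase 0, pointWeight 0 j ≤ (3 * π) ^ (1 : ℝ) * (3 : ℝ) ^ d * aliasConst d 0) := by
  refine ⟨?_, ?_, ?_⟩
  · have h := sum_pointWeight_le hd (α := -1) (by norm_num) K; norm_num at h ⊢; exact h
  · have h := sum_pointWeight_le hd (α := -2) (by norm_num) K; norm_num at h ⊢; exact h
  · have h := sum_pointWeight_le hd (α := 0) (by norm_num) K; norm_num at h ⊢; exact h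

/-! ## §4 The torus form: aliases `m : TorusSite D N` through the symmetric representative -/

section Torus

open Literature.Probability.LatticeModels (TorusSite)
open Summit.QuantumFields.BalabanUV.Beta.GAN24.AliasReindex (srep srep_injective intCast_srep)

variable {D N : ℕ} [NeZero N]

omit [NeZero N] in
/-- [folklore] A nonzero alias class has a nonzero symmetric representative. -/
theorem srep_ne_zero {m : TorusSite D N} (hm : m ≠ 0) : srep m ≠ 0 := by
  intro h
  apply hm
  funext i
  have hi := intCast_srep m i
  rw [show srep m i = 0 from congrFun h i, Int.cast_zero] at hi
  exact hi.symm

/-- [folklore] **THE TORUS FORM OF THE WINDOW-FREE BOUND**: summing the `p`-free point-reading weight of the symmetric representatives over the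
NONZERO alias classes of block side `N` is bounded by King's constant, uniformly in `N` (`D ≥ 1`, `α < 1`). -/
theorem sum_pointWeight_srep_le (hD : 0 < D) {α : ℝ} (hα : α < 1) :
    ∑ m ∈ (Finset.univ : Finset (TorusSite D N)).filter (fun m => m ≠ 0), pointWeight α (srep m)
      ≤ (3 * π) ^ (1 - α) * (3 : ℝ) ^ D * aliasConst D α := by
  classical
  set S : Finset (TorusSite D N) := (Finset.univ : Finset (TorusSite D N)).filter (fun m => m ≠ 0) with hS
  have hinj : Set.InjOn (srep : TorusSite D N → Fin D → ℤ) S := fun a _ b _ h => srep_injective h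
  rw [← Finset.sum_image hinj]
  refine sum_pointWeight_le_of_subset hD hα ?_
  intro h0
  obtain ⟨m, hm, hm0⟩ := Finset.mem_image.1 h0
  exact srep_ne_zero (Finset.mem_filter.1 hm).2 hm0

end Torus

end Summit.QuantumFields.BalabanUV.Beta.GAN24.AliasPointSum

end
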